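import Literature.NumberTheory.EllipticCurves.X1ElevenFiveIsogeny
import Literature.NumberTheory.EllipticCurves.MazurTorsionLocalStepsProofs
import Literature.NumberTheory.EllipticCurves.VariableChangePointsMap
import Literature.NumberTheory.EllipticCurves.KramerCurvesPadic
import HarnessLib

/-!
# The `5`-descent on `X₁(11)`, IV-c: translating a rational point of `11A1` by `⟨T'⟩` off the
# node at `11`

Local input at the bad prime `11` for the explicit Eisenstein `5`-descent on `X₁(11)`
(B. Mazur, *Modular curves and the Eisenstein ideal*, Publ. Math. IHÉS 47 (1977), Ch. III §3;
overview in `X1ElevenKummerValues`). The curve `11A1 : y² + y = x³ - x² - 10x - 20` has split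
multiplicative reduction of Kodaira type `I₅` at `11`, with node `(5, 5) mod 11`, and the rational
`5`-torsion point `T' = (5, 5)` reduces to the node. By the Kodaira–Néron theorem over the
Henselian ring `ℤ₁₁` (tree `index_goodReductionSubgroup_eq_of_hasSplitMultiplicativeReduction`:
`[E'(ℚ₁₁) : E'₀(ℚ₁₁)] = ord₁₁ Δ = 5`) the component group `E'(ℚ₁₁)/E'₀(ℚ₁₁) ≅ ℤ/5` is generated
by the class of `T'`; hence:

> **`exists_sub_nsmul_T'_not_node`**: for every `P' ∈ 11A1(ℚ)` there is `k : ℕ` such that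
> `P' - k • T'` does not reduce to the node `(5, 5)` of `11A1 mod 11` (i.e. it lies on the
> identity component `E'₀` at `11`).

This is the input that lets the global step (`X1ElevenDescentGalois`: a `Γ_ℚ`-stable coset of
`ker φ` over a rational point *off the node class* is rational) be applied to an arbitrary
rational point of `11A1` after a translation by `⟨T'⟩ = φ(11A3[5])`.

## References

* [Mazur1977] B. Mazur, *Modular curves and the Eisenstein ideal*, Publ. Math. IHÉS 47 (1977),
  Ch. III §3 and §5 (Step 3, the fibre at `N`).
* [SilvermanATAEC1994] J. H. Silverman, *Advanced Topics in the Arithmetic of Elliptic Curves*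
  (1994), Cor. IV.9.2(d) with (b) (PDF p. 340): split multiplicative `I_n` over a Henselian
  ring has component group `ℤ/n`.
* [CremonaAlgorithms1997] J. E. Cremona, *Algorithms for Modular Elliptic Curves*, 2nd ed.
  (1997), Table 1, `N = 11`, curve A1 (`I₅` at `11`, `c₁₁ = 5`).

## Design

Theorems and one real definition (`curve11A1Int`, the `ℤ₁₁`-integral equation); the predicate
"reduces to the node" is spelled out on numerators and denominators exactly as in
`X1ElevenDescentGalois.ReducesToNode11` (kept unfolded here so that the two files are
independent).
-/

noncomputable section

open scoped Classical
open WeierstrassCurve IsDedekindDomain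

namespace Literature.NumberTheory.EllipticCurves.X1Eleven

open Literature.NumberTheory.EllipticCurves

/-- `11` is prime. [folklore] -/
instance factPrimeEleven : Fact (Nat.Prime 11) := ⟨by decide⟩

/-! ### `11A1` over `ℚ₁₁` -/

/-- The `ℤ₁₁`-integral equation `y² + y = x³ - x² - 10x - 20` of `11A1`.
[cite: CremonaAlgorithms1997, Table 1, N = 11, curve A1 [0,-1,1,-10,-20]] -/
def curve11A1Int : WeierstrassCurve ℤ_[11] := ⟨0, -1, 1, -10, -20⟩

/-- `a₁ = 0`. [cite: CremonaAlgorithms1997, Table 1, N = 11, curve A1 [0,-1,1,-10,-20]] -/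
@[simp] lemma curve11A1Int_a₁ : curve11A1Int.a₁ = 0 := rfl

/-- `a₂ = -1`. [cite: CremonaAlgorithms1997, Table 1, N = 11, curve A1 [0,-1,1,-10,-20]] -/
@[simp] lemma curve11A1Int_a₂ : curve11A1Int.a₂ = -1 := rfl

/-- `a₃ = 1`. [cite: CremonaAlgorithms1997, Table 1, N = 11, curve A1 [0,-1,1,-10,-20]] -/
@[simp] lemma curve11A1Int_a₃ : curve11A1Int.a₃ = 1 := rfl

/-- `a₄ = -10`. [cite: CremonaAlgorithms1997, Table 1, N = 11, curve A1 [0,-1,1,-10,-20]] -/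
@[simp] lemma curve11A1Int_a₄ : curve11A1Int.a₄ = -10 := rfl

/-- `a₆ = -20`. [cite: CremonaAlgorithms1997, Table 1, N = 11, curve A1 [0,-1,1,-10,-20]] -/
@[simp] lemma curve11A1Int_a₆ : curve11A1Int.a₆ = -20 := rfl

/-- `11A1 ⊗ ℚ₁₁` is the base change of the integral equation. [folklore] -/
theorem curve11A1_baseChange_padic :
    curve11A1.baseChange ℚ_[11] = curve11A1Int.baseChange ℚ_[11] := by
  simp only [WeierstrassCurve.baseChange, WeierstrassCurve.map, curve11A1, curve11A1Int,
    map_zero, map_one, map_neg, map_ofNat]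

/-- The equation is `ℤ₁₁`-integral. [folklore] -/
instance isIntegral_curve11A1Int :
    (curve11A1Int.baseChange ℚ_[11]).IsIntegral ℤ_[11] := ⟨⟨curve11A1Int, rfl⟩⟩

/-- `Δ(11A1) = -11⁵` over `ℚ₁₁`. [cite: CremonaAlgorithms1997, Table 1, N = 11, curve A1] -/
theorem curve11A1Int_baseChange_Δ : (curve11A1Int.baseChange ℚ_[11]).Δ = -11 ^ 5 := by
  rw [← curve11A1_baseChange_padic, WeierstrassCurve.baseChange, map_Δ, curve11A1_Δ, map_neg,
    map_pow, map_ofNat]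

/-- `11A1 ⊗ ℚ₁₁` is an elliptic curve. [folklore] -/
instance isElliptic_curve11A1Int : (curve11A1Int.baseChange ℚ_[11]).IsElliptic :=
  ⟨by rw [curve11A1Int_baseChange_Δ]; exact isUnit_iff_ne_zero.mpr (by norm_num)⟩

/-- `v₁₁(11) = exp(-1)`. [folklore] -/
theorem valuation_eleven :
    (IsDiscreteValuationRing.maximalIdeal ℤ_[11]).valuation ℚ_[11] (11 : ℚ_[11]) =
      WithZero.exp (-1 : ℤ) := by
  rw [← map_ofNat (algebraMap ℤ_[11] ℚ_[11]) 11,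
    (IsDiscreteValuationRing.maximalIdeal ℤ_[11]).valuation_of_algebraMap (K := ℚ_[11])]
  refine HeightOneSpectrum.intValuation_singleton _ (by norm_num) ?_
  show IsLocalRing.maximalIdeal ℤ_[11] = _
  rw [PadicInt.maximalIdeal_eq_span_p, Nat.cast_ofNat]

/-- `v₁₁(Δ) = exp(-5)`. [cite: CremonaAlgorithms1997, Table 1, N = 11, curve A1 (ord₁₁ Δ = 5)] -/
theorem valuation_Δ_curve11A1Int :
    (IsDiscreteValuationRing.maximalIdeal ℤ_[11]).valuation ℚ_[11]
        (curve11A1Int.baseChange ℚ_[11]).Δ = WithZero.exp (-5 : ℤ) := by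
  rw [curve11A1Int_baseChange_Δ, Valuation.map_neg, Valuation.map_pow, valuation_eleven,
    ← WithZero.exp_nsmul]
  norm_num

/-- `c₄(11A1) = 496 = 2⁴ · 31`. [cite: CremonaAlgorithms1997, Table 1, N = 11, curve A1] -/
theorem curve11A1Int_baseChange_c₄ : (curve11A1Int.baseChange ℚ_[11]).c₄ = 496 := by
  rw [← curve11A1_baseChange_padic, WeierstrassCurve.baseChange, map_c₄]
  have : curve11A1.c₄ = 496 := by
    norm_num [WeierstrassCurve.c₄, WeierstrassCurve.b₂, WeierstrassCurve.b₄]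
  rw [this, map_ofNat]

/-- `496` is an `11`-adic unit: `v₁₁(c₄) = 1`. [folklore] -/
theorem valuation_c₄_curve11A1Int :
    (IsDiscreteValuationRing.maximalIdeal ℤ_[11]).valuation ℚ_[11]
        (curve11A1Int.baseChange ℚ_[11]).c₄ = 1 := by
  rw [curve11A1Int_baseChange_c₄, ← map_ofNat (algebraMap ℤ_[11] ℚ_[11]) 496,
    HeightOneSpectrum.valuation_eq_one_iff_notMem]
  show (496 : ℤ_[11]) ∉ IsLocalRing.maximalIdeal ℤ_[11]
  rw [IsLocalRing.mem_maximalIdeal, PadicInt.mem_nonunits]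
  intro hlt
  have h := (PadicInt.norm_int_lt_one_iff_dvd (p := 11) 496).mp (by exact_mod_cast hlt)
  norm_num at h

/-- The equation `y² + y = x³ - x² - 10x - 20` is `ℤ₁₁`-minimal (`c₄` is a unit; Silverman,
*AEC* VII.1 Remark 1.1, tree `isMinimal_of_valuation_c₄_eq_one`).
[cite: SilvermanAEC2009, VII.1 Remark 1.1] -/
instance isMinimal_curve11A1Int : (curve11A1Int.baseChange ℚ_[11]).IsMinimal ℤ_[11] :=
  WeierstrassCurve.isMinimal_of_valuation_c₄_eq_one _ valuation_c₄_curve11A1Int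

/-- The residue field `𝔽₁₁` of `ℤ₁₁` is finite. [folklore] -/
instance finite_residueField_eleven : Finite (IsLocalRing.ResidueField ℤ_[11]) :=
  Finite.of_equiv (ZMod 11) (PadicInt.residueField (p := 11)).symm.toEquiv

/-- `11 = 0` in the residue field of `ℤ₁₁`. [folklore] -/
theorem eleven_eq_zero_residueField : (11 : IsLocalRing.ResidueField ℤ_[11]) = 0 := by
  rw [← map_ofNat (IsLocalRing.residue ℤ_[11]) 11,
    IsLocalRing.residue_eq_zero_iff, PadicInt.maximalIdeal_eq_span_p, Nat.cast_ofNat]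
  exact Ideal.mem_span_singleton_self _

/-- **`(5, 5)` is the node of `11A1 mod 11`**: both partial derivatives vanish there
(`F_x(5,5) = -55`, `F_y(5,5) = 11`). [cite: CremonaAlgorithms1997, Table 1, N = 11, curve A1 (I₅ at 11)] -/
theorem not_nonsingular_node :
    ¬ (curve11A1Int.map (IsLocalRing.residue ℤ_[11])).toAffine.Nonsingular
      (IsLocalRing.residue ℤ_[11] 5) (IsLocalRing.residue ℤ_[11] 5) := by
  intro hns
  rw [Affine.nonsingular_iff'] at hns
  obtain ⟨-, hpart⟩ := hns
  simp only [map_a₁, map_a₂, map_a₃, map_a₄, curve11A1Int_a₁, curve11A1Int_a₂,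
    curve11A1Int_a₃, curve11A1Int_a₄, map_zero, map_one, map_neg, map_ofNat] at hpart
  have h11 := eleven_eq_zero_residueField
  rcases hpart with h | h <;> apply h
  · linear_combination (-5 : IsLocalRing.ResidueField ℤ_[11]) * h11
  · linear_combination h11

/-! ### Rational points in `E'(ℚ₁₁)` -/

/-- The map `11A1(ℚ) → 11A1(ℚ₁₁)` with values in the points of the integral equation.
[folklore] -/
def toPadicPoint : curve11A1.toAffine.Point →+ (curve11A1Int.baseChange ℚ_[11]).toAffine.Point :=
  (Affine.Point.congrEquiv curve11A1_baseChange_padic).toAddMonoidHom.comp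
    (Affine.Point.map (W' := curve11A1.toAffine) (S := ℚ) (Algebra.ofId ℚ ℚ_[11]))

/-- `toPadicPoint` on an affine point. [folklore] -/
theorem toPadicPoint_some {x y : ℚ} (h : curve11A1.toAffine.Nonsingular x y) :
    ∃ h', toPadicPoint (Affine.Point.some x y h) =
      Affine.Point.some (x : ℚ_[11]) (y : ℚ_[11]) h' := by
  have e : toPadicPoint (Affine.Point.some x y h) =
      Affine.Point.congrEquiv curve11A1_baseChange_padic
        (Affine.Point.map (W' := curve11A1.toAffine) (S := ℚ) (Algebra.ofId ℚ ℚ_[11])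
          (Affine.Point.some x y h)) := rfl
  rw [Affine.Point.map_some, Affine.Point.congrEquiv_some] at e
  exact ⟨_, e⟩

/-- `toPadicPoint` is injective. [folklore] -/
theorem toPadicPoint_injective : Function.Injective toPadicPoint :=
  (Affine.Point.congrEquiv curve11A1_baseChange_padic).injective.comp
    (Affine.Point.map_injective (W' := curve11A1.toAffine) (f := Algebra.ofId ℚ ℚ_[11]))

/-- `T' = (5, 5)` in `E'(ℚ₁₁)` has `ℤ₁₁`-integral coordinates `(5, 5)`. [folklore] -/
theorem toPadicPoint_T' :
    ∃ h', toPadicPoint T' = Affine.Point.some (algebraMap ℤ_[11] ℚ_[11] 5)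
      (algebraMap ℤ_[11] ℚ_[11] 5) h' := by
  obtain ⟨h', e⟩ := toPadicPoint_some (x := 5) (y := 5) ((Affine.nonsingular_iff' _ _).mpr
    ⟨(Affine.equation_iff _ _).mpr (by norm_num [curve11A1]), Or.inr (by norm_num [curve11A1])⟩)
  have e' : toPadicPoint T' = Affine.Point.some ((5 : ℚ) : ℚ_[11]) ((5 : ℚ) : ℚ_[11]) h' := e
  have h5 : ((5 : ℚ) : ℚ_[11]) = algebraMap ℤ_[11] ℚ_[11] 5 := by
    rw [Rat.cast_ofNat, map_ofNat]
  have h'' : (curve11A1Int.baseChange ℚ_[11]).toAffine.Nonsingular (algebraMap ℤ_[11] ℚ_[11] 5)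
      (algebraMap ℤ_[11] ℚ_[11] 5) := by rwa [h5] at h'
  exact ⟨h'', e'.trans (some_eq_some_of_eq h5 h5 _ _)⟩

/-- A rational number with denominator prime to `11` is an `11`-adic integer. [folklore] -/
theorem exists_padicInt_eq {x : ℚ} (hx : ¬ (11 : ℤ) ∣ x.den) :
    ∃ z : ℤ_[11], algebraMap ℤ_[11] ℚ_[11] z = x :=
  ⟨⟨x, Padic.norm_rat_le_one fun h => hx (by exact_mod_cast h)⟩, rfl⟩

/-- `x ≡ 5 (mod 11)` read on numerator and denominator gives `‖x - 5‖₁₁ < 1`. [folklore] -/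
theorem padicNorm_sub_five_lt_one {x : ℚ} (hd : ¬ (11 : ℤ) ∣ x.den)
    (hn : (11 : ℤ) ∣ x.num - 5 * x.den) : ‖(x : ℚ_[11]) - 5‖ < 1 := by
  have hD0 : ((x.den : ℤ) : ℚ_[11]) ≠ 0 := by exact_mod_cast x.den_nz
  have hx : (x : ℚ_[11]) - 5 = ((x.num - 5 * x.den : ℤ) : ℚ_[11]) / ((x.den : ℤ) : ℚ_[11]) := by
    rw [eq_div_iff hD0, Rat.cast_def x]
    have hD0' : ((x.den : ℕ) : ℚ_[11]) ≠ 0 := by exact_mod_cast x.den_nz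
    field_simp
    push_cast
    ring
  rw [hx, norm_div]
  have hD : ‖((x.den : ℤ) : ℚ_[11])‖ = 1 :=
    le_antisymm (Padic.norm_int_le_one _)
      (not_lt.mp fun h => hd (by exact_mod_cast Padic.norm_intCast_lt_one_iff.mp h))
  rw [hD, div_one]
  exact Padic.norm_intCast_lt_one_iff.mpr (by exact_mod_cast hn)

/-- If `‖z - 5‖ < 1` for `z ∈ ℤ₁₁` then `z̄ = 5̄` in `𝔽₁₁`. [folklore] -/
theorem residue_eq_residue_five {z : ℤ_[11]} (hz : ‖(algebraMap ℤ_[11] ℚ_[11] z) - 5‖ < 1) :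
    IsLocalRing.residue ℤ_[11] z = IsLocalRing.residue ℤ_[11] 5 := by
  rw [← sub_eq_zero, ← map_sub, IsLocalRing.residue_eq_zero_iff, IsLocalRing.mem_maximalIdeal,
    PadicInt.mem_nonunits, PadicInt.norm_def, PadicInt.coe_sub]
  rwa [PadicInt.algebraMap_apply, ← map_ofNat PadicInt.Coe.ringHom 5] at hz

/-! ### The main theorem -/

/-- **Every rational point of `11A1` has a translate by `⟨T'⟩` on the identity component at
`11`**: for `P' ∈ 11A1(ℚ)` there is `k : ℕ` such that `P' - k • T'` does *not* reduce to the
node `(5, 5)` of `11A1 mod 11` — it is not an affine point `(x, y)` with `11`-integral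
coordinates `x ≡ y ≡ 5 (mod 11)`. Proof: `[E'(ℚ₁₁) : E'₀(ℚ₁₁)] = ord₁₁(Δ) = 5` (Kodaira–Néron for
split multiplicative reduction over the Henselian ring `ℤ₁₁`), the class of `T'` is non-trivial
(it reduces to the node), hence generates; and points of `E'₀(ℚ₁₁)` with integral coordinates
reduce to nonsingular points.
[cite: SilvermanATAEC1994, Cor. IV.9.2(d) with (b) (PDF p. 340); Mazur1977, Ch. III §5 Step 3, p. 159] -/
theorem exists_sub_nsmul_T'_not_node (P' : curve11A1.toAffine.Point) :
    ∃ k : ℕ, k < 5 ∧ ¬ ∃ (x y : ℚ) (h : curve11A1.toAffine.Nonsingular x y),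
      P' - k • T' = Affine.Point.some x y h ∧ ¬ (11 : ℤ) ∣ x.den ∧ ¬ (11 : ℤ) ∣ y.den ∧
        (11 : ℤ) ∣ x.num - 5 * x.den ∧ (11 : ℤ) ∣ y.num - 5 * y.den := by
  have hinj : Function.Injective (algebraMap ℤ_[11] ℚ_[11]) := IsFractionRing.injective _ _
  have hv := integers_valuationRing_valuation ℤ_[11] ℚ_[11]
  set H := (curve11A1Int.baseChange ℚ_[11]).goodReductionSubgroup ℤ_[11] with hH
  -- integral points of `E'₀(ℚ₁₁)` have nonsingular reduction
  have hmem : ∀ {a b : ℤ_[11]} (h : (curve11A1Int.baseChange ℚ_[11]).toAffine.Nonsingular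
      (algebraMap ℤ_[11] ℚ_[11] a) (algebraMap ℤ_[11] ℚ_[11] b)),
      Affine.Point.some _ _ h ∈ H →
        (curve11A1Int.map (IsLocalRing.residue ℤ_[11])).toAffine.Nonsingular
          (IsLocalRing.residue ℤ_[11] a) (IsLocalRing.residue ℤ_[11] b) := by
    intro a b h hP
    rw [hH, goodReductionSubgroup_baseChange_eq, mem_nonsingularReductionSubgroup_iff] at hP
    exact (WeierstrassCurve.hasNonsingularReduction_some_algebraMap_iff hinj h).mp hP
  -- `T'` reduces to the node, so it is not in `E'₀`
  obtain ⟨h55, hT⟩ := toPadicPoint_T'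
  have hTnot : toPadicPoint T' ∉ H := fun hTH => by
    rw [hT] at hTH
    exact not_nonsingular_node (hmem h55 hTH)
  have h5T : 5 • toPadicPoint T' = 0 := by rw [← map_nsmul, five_nsmul_T', map_zero]
  -- Kodaira–Néron: split multiplicative, index `5`
  obtain ⟨hsplit, -⟩ := hasSplitMultiplicativeReduction_of_not_mem_goodReductionSubgroup ℤ_[11]
    (curve11A1Int.baseChange ℚ_[11]) (by decide : Nat.Prime 5) le_rfl h5T hTnot
  haveI := hsplit
  obtain ⟨-, hval⟩ :=
    (curve11A1Int.baseChange ℚ_[11]).index_goodReductionSubgroup_eq_of_hasSplitMultiplicativeReduction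
      ℤ_[11]
  rw [valuation_Δ_curve11A1Int, WithZero.exp_inj, neg_inj] at hval
  have hidx : H.index = 5 := by rw [hH]; exact_mod_cast hval.symm
  -- the class of `T'` generates `E'(ℚ₁₁)/E'₀(ℚ₁₁) ≅ ℤ/5`
  set c : (curve11A1Int.baseChange ℚ_[11]).toAffine.Point ⧸ H :=
    QuotientAddGroup.mk (toPadicPoint T') with hc
  have hcard : Nat.card ((curve11A1Int.baseChange ℚ_[11]).toAffine.Point ⧸ H) = 5 := by
    rw [← AddSubgroup.index_eq_card, hidx]
  haveI : Finite ((curve11A1Int.baseChange ℚ_[11]).toAffine.Point ⧸ H) :=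
    Nat.finite_of_card_ne_zero (by rw [hcard]; norm_num)
  have hc0 : c ≠ 0 := fun h0 => hTnot ((QuotientAddGroup.eq_zero_iff _).mp h0)
  have hord : addOrderOf c = 5 := by
    have hdvd : addOrderOf c ∣ 5 := hcard ▸ addOrderOf_dvd_natCard c
    rcases (Nat.dvd_prime (by decide : Nat.Prime 5)).mp hdvd with h1 | h5
    · exact absurd (AddMonoid.addOrderOf_eq_one_iff.mp h1) hc0
    · exact h5
  have htop : AddSubgroup.zmultiples c = ⊤ :=
    AddSubgroup.eq_top_of_card_eq _ (by rw [Nat.card_zmultiples, hord, hcard])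
  -- write the class of `P'` as `k • c` with `k < 5`
  have hPc : (QuotientAddGroup.mk (toPadicPoint P') : _ ⧸ H) ∈ AddSubgroup.zmultiples c := by
    rw [htop]; exact AddSubgroup.mem_top _
  obtain ⟨m, hm⟩ := AddSubgroup.mem_zmultiples_iff.mp hPc
  have h5c : (5 : ℤ) • c = 0 := by
    rw [show (5 : ℤ) = ((5 : ℕ) : ℤ) by rfl, natCast_zsmul, ← hord]
    exact addOrderOf_nsmul_eq_zero c
  set k : ℕ := (m % 5).toNat with hk
  have hk5 : (k : ℤ) = m % 5 := Int.toNat_of_nonneg (Int.emod_nonneg _ (by norm_num))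
  have hklt : k < 5 := by
    have := Int.emod_lt_of_pos m (show (0 : ℤ) < 5 by norm_num)
    omega
  have hkc : (k : ℤ) • c = m • c := by
    conv_rhs => rw [← Int.emod_add_ediv_mul m 5]
    rw [add_zsmul, mul_zsmul, h5c, zsmul_zero, add_zero, hk5]
  refine ⟨k, hklt, ?_⟩
  -- `P' - k • T' ∈ E'₀(ℚ₁₁)`
  have hdiff : toPadicPoint (P' - k • T') ∈ H := by
    rw [map_sub, map_nsmul, ← QuotientAddGroup.eq_iff_sub_mem, QuotientAddGroup.mk_nsmul, ← hc,
      ← hm, ← hkc, natCast_zsmul]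
  -- a point reducing to the node is not in `E'₀(ℚ₁₁)`
  rintro ⟨x, y, h, hPe, hxd, hyd, hxn, hyn⟩
  rw [hPe] at hdiff
  obtain ⟨h', e⟩ := toPadicPoint_some h
  rw [e] at hdiff
  obtain ⟨zx, hzx⟩ := exists_padicInt_eq hxd
  obtain ⟨zy, hzy⟩ := exists_padicInt_eq hyd
  have h'' : (curve11A1Int.baseChange ℚ_[11]).toAffine.Nonsingular (algebraMap ℤ_[11] ℚ_[11] zx)
      (algebraMap ℤ_[11] ℚ_[11] zy) := by rw [hzx, hzy]; exact h'
  have hP : Affine.Point.some _ _ h'' ∈ H := by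
    have : Affine.Point.some _ _ h'' = Affine.Point.some (x : ℚ_[11]) (y : ℚ_[11]) h' :=
      some_eq_some_of_eq hzx hzy _ _
    rw [this]; exact hdiff
  have hns := hmem h'' hP
  rw [residue_eq_residue_five (z := zx) (by rw [hzx]; exact padicNorm_sub_five_lt_one hxd hxn),
    residue_eq_residue_five (z := zy) (by rw [hzy]; exact padicNorm_sub_five_lt_one hyd hyn)] at hns
  exact not_nonsingular_node hns

end Literature.NumberTheory.EllipticCurves.X1Eleven

end
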